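import Summits.QuantumFields.YangMills.Theses.EquipartitionCriticality

/-!
# `EquipartitionCriticality.Assembly` — the assembly item of route `EquipartitionCriticality`

Route `EquipartitionCriticality` (sub-problem `YangMills` of summit `QuantumFields`) files, as its
assembly item `Assembly` (stmt-QuantumFields-8766), the implication chain

`FreeEnergyLogCoefficient → EquipartitionPinsProbe → RPProbeCriticality → LatticeGapLargeBeta →
 CriticalContinuumLimit → YangMills`.

This is *verbatim* the type of the route's deciding theorem
`Summit.QuantumFields.YangMills.Theses.EquipartitionCriticality.closes` (planner-authored,
sorry-free, kernel-checked with the route file). Its content is pure bookkeeping: fix a compact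
simple `G` with its Borel σ-algebra; `FreeEnergyLogCoefficient` gives the log-β coefficient of the
torus free energy for every faithful unitary lattice representation `r`; `EquipartitionPinsProbe`
turns it into the β → ∞ probe-covariance limit for every `r`; `RPProbeCriticality` turns that into
criticality (every admissible volume-uniform clustering rate tends to `0`) for every `r`;
`LatticeGapLargeBeta` gives the volume-uniform gap at all large β for every `r`; and
`CriticalContinuumLimit` consumes gap + criticality and returns the body of `YangMills` under the
same `letI := borel G` binders.
This file closes the item by that definitional unfolding; it adds no mathematics of its own.

Sources: route-internal (the deciding theorem `closes`); Jaffe–Witten 2000 for the clauses packaged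
in `YangMills`; Chatterjee (arXiv:1803.01950, Problem 5.1) for the gap/criticality shapes.
Deliberately NOT here: any of the cruxes (`FreeEnergyLogCoefficient`, `EquipartitionPinsProbe`,
`LatticeGapLargeBeta`, `CriticalContinuumLimit`) or supports (`RPProbeCriticality`,
`LogConvexContraction`, `SubgradientLogSqueeze`) — they stay items of the route.
-/

namespace Summit.QuantumFields.YangMills.Theorems

/-- **`EquipartitionCriticality.Assembly` holds** (assembly item stmt-QuantumFields-8766): the chain
`FreeEnergyLogCoefficient → EquipartitionPinsProbe → RPProbeCriticality → LatticeGapLargeBeta →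
CriticalContinuumLimit → YangMills`.
Proof: after unfolding, the goal is literally the type of the route's sorry-free deciding theorem
`EquipartitionCriticality.closes` (for each compact simple `G`, feed `CriticalContinuumLimit` with
the gap of `LatticeGapLargeBeta` and the criticality obtained by chaining
`FreeEnergyLogCoefficient`, `EquipartitionPinsProbe`, `RPProbeCriticality`). [folklore] -/
theorem equipartitionCriticality_assembly_proof :
    Summit.QuantumFields.YangMills.Theses.EquipartitionCriticality.Assembly := by
  unfold Summit.QuantumFields.YangMills.Theses.EquipartitionCriticality.Assembly
  exact Summit.QuantumFields.YangMills.Theses.EquipartitionCriticality.closes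

end Summit.QuantumFields.YangMills.Theorems
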